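import Literature.AlgebraicGeometry.HodgeTheory.GysinProjectionNonvanishing
import HarnessLib

/-!
# Gysin base change for a trivial family along an arbitrary morphism

Family `hodge`, layer `Literature/AlgebraicGeometry/HodgeTheory`. Companion to `GysinBaseChange`
(`gysin_baseChange`: base change of the projection `fst : Y ⊗ Z → Y` along the PROJECTION
`snd : X ⊗ Y → Y`). Here the projection `snd : Y ⊗ X → X` of a trivial family with smooth
projective fibre `Y` is base-changed along an ARBITRARY morphism `f : X' ⟶ X` of smooth projective
complex varieties — the cartesian square

  `Y ⊗ X' —(Y ◁ f)→ Y ⊗ X`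
  `   | snd             | snd`
  `   X'  ———— f ————→  X`,        `f^* ∘ snd_* = c • snd_* ∘ (Y ◁ f)^*`

(W. Fulton, *Intersection Theory* (1998), Prop. 1.7 "push-forward and flat pull-back commute" for
the flat `f`-independent projection, and §19.2 for the topological side; *Young Tableaux* (1997),
App. B (5)–(6)). For the tree's Gysin morphisms `complexGysin μ` (`D_X⁻¹ ∘ f(ℂ)_* ∘ D_Y`, relative to
an ARBITRARY orientation family `μ`, so that every such identity holds only up to a scalar `c`
recording the unrelated normalisations of `μ` on `Y ⊗ X`, `Y ⊗ X'`, `X`, `X'`):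

* `gysin_trivialFamily_baseChange` — **the base change**: there is ONE `c ∈ ℂ` with
  `f^*(snd_* u) = c • snd'_*((Y ◁ f)^* u)` for all `u ∈ Hᵏ((Y ⊗ X)(ℂ); ℂ)` and all degrees `k`.
  Proof: both sides are linear in `u`, so it is checked on the Künneth generators `fst^* b ∪ snd^* w`
  (`kunnethSpan_complexBetti`); after graded commutation the projection formula (`complexGysin_cup`)
  gives `f^* w ∪ f^*(snd_* fst^* b)` and `f^* w ∪ snd'_*(fst'^* b)`, which vanish for `deg b < 2m`
  (`complexGysin_cup_map_eq_zero_of_lt`) and whose degree-`0` factors are, for `deg b = 2m`, two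
  linear functions of `b ∈ H²ᵐ(Y(ℂ)) ≅ ℂ` with values in `ℂ · 1`, the second one non-zero for some
  `b` (`exists_complexGysin_snd_map_fst_ne_zero`, `GysinProjectionNonvanishing`), hence proportional,
  with a ratio `c` independent of `b` and of the degree.

This is step (2) of the clean-intersection base change `GysinCleanBaseChange` (graph trick).
Everything is proved; no definitions, no named facts.

## References

* [Fulton1998] W. Fulton, Intersection Theory, 2nd ed., Springer 1998, Prop. 1.7, §19.2.
* [FultonYoungTableaux1997] W. Fulton, Young Tableaux, CUP 1997, Appendix B §B.1 (5)–(6).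
* [HatcherAT2002] A. Hatcher, Algebraic Topology, CUP 2002, §3.1 Thm. 3.2, §3.2 Thm. 3.15.
-/

noncomputable section

open CategoryTheory AlgebraicGeometry MonoidalCategory CartesianMonoidalCategory
open Literature.AlgebraicGeometry.Motives
open Literature.AlgebraicTopology.SingularHomology

namespace Literature.AlgebraicGeometry.HodgeTheory

section HodgeTheory

variable {m n n' : ℕ} {Y X X' : SchemeOver ℂ}

/-! ### The base change -/

/-- **Gysin base change for the trivial family `snd : Y ⊗ X → X` along an arbitrary morphism
`f : X' ⟶ X`** of smooth projective complex varieties (dimensions `m`, `n`, `n'`): there is ONE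
`c ∈ ℂ` such that, in all degrees `k + 2n = k₁ + 2(m + n)`,

  `f^* (snd_* u) = c • snd_* ((Y ◁ f)^* u)`   for all `u ∈ Hᵏ((Y ⊗ X)(ℂ); ℂ)`,

the second `snd` being the projection `Y ⊗ X' → X'` (Fulton, Prop. 1.7 / §19.2; the scalar `c`
records the normalisations of the arbitrary orientation family `μ`). Both sides are linear in `u`
and agree on the Künneth generators `fst^* b ∪ snd^* w` (`kunnethSpan_complexBetti`): for
`deg b < 2m` both vanish (`complexGysin_cup_map_eq_zero_of_lt`), for `deg b > 2m` `b = 0`, and for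
`deg b = 2m` the projection formula leaves `f^* w ∪ f^*(snd_* fst^* b)` and `f^* w ∪ snd_*(fst^* b)`,
whose degree-`0` factors are linear in `b ∈ H²ᵐ(Y(ℂ)) ≅ ℂ`, multiples of `1`, the second non-zero
for some `b` (`exists_complexGysin_snd_map_fst_ne_zero`). [cite: Fulton1998, Prop. 1.7 and §19.2]
[cite: FultonYoungTableaux1997, Appendix B §B.1 (5)–(6)] [cite: HatcherAT2002, §3.2 Thm. 3.15] -/
theorem gysin_trivialFamily_baseChange (μ : OrientationFamily)
    (hY : IsSmoothProjective m Y) (hX : IsSmoothProjective n X) (hX' : IsSmoothProjective n' X')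
    (f : X' ⟶ X) :
    ∃ c : ℂ, ∀ ⦃k k₁ : ℕ⦄ (hk : k + 2 * n = k₁ + 2 * (m + n)) (u : complexBetti (Y ⊗ X) k),
      complexBetti.map f k₁
        (complexGysin μ (IsSmoothProjective.tensor_holds hY hX) hX (snd Y X) hk u) =
      c • complexGysin μ (IsSmoothProjective.tensor_holds hY hX') hX' (snd Y X')
          (show k + 2 * n' = k₁ + 2 * (m + n') by omega) (complexBetti.map (Y ◁ f) k u) := by
  have hμ : μ.HasPoincareDuality := OrientationFamily.hasPoincareDuality μ
  have hT := IsSmoothProjective.tensor_holds hY hX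
  have hT' := IsSmoothProjective.tensor_holds hY hX'
  -- the degree-`0` fibre integrals `A b = f^*(snd_* fst^* b)`, `B b = snd'_*(fst'^* b)`
  let A : complexBetti Y (2 * m) →ₗ[ℂ] complexBetti X' 0 :=
    (complexBetti.map f 0).hom ∘ₗ
      complexGysin μ hT hX (snd Y X) (show 2 * m + 2 * n = 0 + 2 * (m + n) by omega) ∘ₗ
      (complexBetti.map (fst Y X) (2 * m)).hom
  let B : complexBetti Y (2 * m) →ₗ[ℂ] complexBetti X' 0 :=
    complexGysin μ hT' hX' (snd Y X') (show 2 * m + 2 * n' = 0 + 2 * (m + n') by omega) ∘ₗ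
      (complexBetti.map (fst Y X') (2 * m)).hom
  obtain ⟨b₁, hb₁⟩ := exists_complexGysin_snd_map_fst_ne_zero μ hY hX'
  have hBb₁ : B b₁ ≠ 0 := hb₁
  have hb₁0 : b₁ ≠ 0 := by
    rintro rfl
    exact hBb₁ (map_zero B)
  obtain ⟨α, hα⟩ := exists_eq_smul_one μ hX
    (complexGysin μ hT hX (snd Y X) (show 2 * m + 2 * n = 0 + 2 * (m + n) by omega)
      (complexBetti.map (fst Y X) (2 * m) b₁))
  have hα' : A b₁ = α • singularCohomology.one ℂ (ComplexPoints X') := by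
    change complexBetti.map f 0 (complexGysin μ hT hX (snd Y X) _
      (complexBetti.map (fst Y X) (2 * m) b₁)) = _
    rw [hα, map_smul]
    change α • singularCohomology.map ℂ ℂ _ 0 (singularCohomology.one ℂ _) = _
    rw [singularCohomology.map_one]
  obtain ⟨β, hβ⟩ := exists_eq_smul_one μ hX' (B b₁)
  have hβ0 : β ≠ 0 := by
    rintro rfl
    exact hBb₁ (by rw [hβ, zero_smul])
  -- `A = (α β⁻¹) • B` on the line `H²ᵐ(Y(ℂ)) = ℂ · b₁`
  have hAB : ∀ b, A b = (α * β⁻¹) • B b := by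
    intro b
    obtain ⟨t, rfl⟩ := exists_eq_smul_of_top μ hY hb₁0 b
    simp only [map_smul, hα', hβ, smul_smul]
    congr 1
    field_simp
  refine ⟨α * β⁻¹, fun k k₁ hk u ↦ ?_⟩
  -- both sides are linear in `u`: check on cross products
  let F : complexBetti (Y ⊗ X) k →ₗ[ℂ] complexBetti X' k₁ :=
    (complexBetti.map f k₁).hom ∘ₗ complexGysin μ hT hX (snd Y X) hk
  let G : complexBetti (Y ⊗ X) k →ₗ[ℂ] complexBetti X' k₁ :=
    (α * β⁻¹) • (complexGysin μ hT' hX' (snd Y X')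
      (show k + 2 * n' = k₁ + 2 * (m + n') by omega) ∘ₗ (complexBetti.map (Y ◁ f) k).hom)
  change F u = G u
  refine LinearMap.eqOn_span (f := F) (g := G) ?_ (kunnethSpan_complexBetti hY hX k u)
  rintro _ ⟨i, j, hij, b, w, rfl⟩
  -- graded commutation: it suffices to treat `snd^* w ∪ fst^* b`
  have hji : j + i = k := by omega
  rw [cupProduct_gradedComm_holds ℂ _ hij hji, map_smul, map_smul]
  congr 1
  change complexBetti.map f k₁ (complexGysin μ hT hX (snd Y X) hk
      (cupProduct hji (complexBetti.map (snd Y X) j w) (complexBetti.map (fst Y X) i b))) =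
    (α * β⁻¹) • complexGysin μ hT' hX' (snd Y X') _ (complexBetti.map (Y ◁ f) k
      (cupProduct hji (complexBetti.map (snd Y X) j w) (complexBetti.map (fst Y X) i b)))
  -- `(Y ◁ f)^*(snd^* w ∪ fst^* b) = snd'^* (f^* w) ∪ fst'^* b` on `Y ⊗ X'`
  have epull : complexBetti.map (Y ◁ f) k
      (cupProduct hji (complexBetti.map (snd Y X) j w) (complexBetti.map (fst Y X) i b)) =
      cupProduct hji (complexBetti.map (snd Y X') j (complexBetti.map f j w))
        (complexBetti.map (fst Y X') i b) := by
    rw [cupProduct_map, ← CategoryTheory.comp_apply (f := complexBetti.map (snd Y X) j),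
      ← complexBetti.map_comp, whiskerLeft_snd, complexBetti.map_comp, CategoryTheory.comp_apply,
      ← CategoryTheory.comp_apply (f := complexBetti.map (fst Y X) i), ← complexBetti.map_comp,
      whiskerLeft_fst]
  rw [epull]
  rcases lt_trichotomy i (2 * m) with hi | hi | hi
  · -- below the fibre dimension both sides vanish
    rw [complexGysin_cup_map_eq_zero_of_lt hT hX (snd Y X) hji hk (by omega) w,
      complexGysin_cup_map_eq_zero_of_lt hT' hX' (snd Y X') hji _ (by omega), map_zero, smul_zero]
  swap
  · haveI := subsingleton_complexBetti hY hi
    rw [Subsingleton.elim b 0, map_zero, map_zero, map_zero, map_zero, map_zero, map_zero, map_zero,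
      smul_zero]
  subst hi
  obtain rfl : j = k₁ := by omega
  -- projection formula on both sides
  rw [complexGysin_cup hμ hT hX (snd Y X) hji hk (show 2 * m + 2 * n = 0 + 2 * (m + n) by omega)
      (Nat.add_zero _) w, cupProduct_map,
    complexGysin_cup hμ hT' hX' (snd Y X') hji _
      (show 2 * m + 2 * n' = 0 + 2 * (m + n') by omega) (Nat.add_zero _)]
  change cupProduct _ (complexBetti.map f j w) (A b) =
    (α * β⁻¹) • cupProduct _ (complexBetti.map f j w) (B b)
  rw [hAB b, map_smul]

end HodgeTheory

end Literature.AlgebraicGeometry.HodgeTheory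

end
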